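import Summits.RiemannHypothesis.RiemannHypothesis.Theorems.MotivicDoorCertPosGram

/-!
# Motivic door / CERTPOS — row-sharded form of the upper-bound witness check

pub-rhdoor (MOTIVIC-DOOR ticket), unit `certpos`. HONEST FRAMING: lottery ticket at the motivic door; RH probability
negligible; this file is instrumentation only (finite integer bookkeeping, RH-free, `ζ`-free).

`GramCert.upperOK w num den` (file `MotivicDoorCertPosGram`) evaluates the double sum
`Σ_i Σ_j (w_i w_j C_ij + |w_i| |w_j| r_ij)` in ONE kernel computation, which exceeds the kernel's memory budget at
`k ≈ 100`. Here the row sums are supplied as DATA `R : List ℤ` and checked row by row in shards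
(`upperRowsOK w R a n`, one `decide +kernel` per shard, exactly like `GramCert.rowsOK`), and the final inequality is
checked on `R` alone (`upperSumOK w R num den`); `upperOK_of_rows` recovers `upperOK w num den = true`, so the landed
soundness theorem `bottomRayleigh_le_of_upperOK` applies unchanged.

## References
- [folklore] splitting a double sum into precomputed row sums.
-/

namespace Summit.RiemannHypothesis.RiemannHypothesis.Theorems.MotivicDoor.CertPos

open Finset Matrix
open Summit.RiemannHypothesis.RiemannHypothesis.Theorems.PfPersistence

namespace GramCert

variable (c : GramCert)

/-- row `i` of the upper-witness double sum: `Σ_j (w_i w_j C_ij + |w_i| |w_j| r_ij)`. [folklore] -/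
def upperRow (w : List ℤ) (i : ℕ) : ℤ :=
  ∑ j ∈ Finset.range c.k, (w.getD i 0 * w.getD j 0 * c.Cij i j + |w.getD i 0| * |w.getD j 0| * (c.rij i j : ℤ))

/-- SHARD CHECK: the supplied row sums `R` agree with `upperRow` on rows `a ≤ i < a + n`. [folklore] -/
def upperRowsOK (w R : List ℤ) (a n : ℕ) : Bool :=
  (List.range' a n).all fun i => decide (R.getD i 0 = c.upperRow w i)

/-- FINAL CHECK on the row sums alone: `w` has length `k`, is nonzero, `0 < den`, and
`(Σ_i R_i) · den ≤ num · 2^t · Σ_i w_i²`. [folklore] -/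
def upperSumOK (w R : List ℤ) (num : ℤ) (den : ℕ) : Bool :=
  decide (w.length = c.k) && decide (0 < den) && ((List.range c.k).any fun i => w.getD i 0 != 0) &&
    decide ((∑ i ∈ Finset.range c.k, R.getD i 0) * (den : ℤ) ≤ num * 2 ^ c.t * ∑ i ∈ Finset.range c.k, w.getD i 0 ^ 2)

/-- PROVED: row shards covering `[0, k)` plus the final check on the row sums give `upperOK`. [folklore] -/
theorem upperOK_of_rows (w R : List ℤ) (num : ℤ) (den : ℕ) (n s : ℕ) (hn : 0 < n) (hcover : c.k ≤ n * s)
    (hrows : ∀ q < s, c.upperRowsOK w R (n * q) n = true) (hsum : c.upperSumOK w R num den = true) :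
    c.upperOK w num den = true := by
  have hrow : ∀ i < c.k, R.getD i 0 = c.upperRow w i := by
    intro i hi
    have h := hrows (i / n) ((Nat.div_lt_iff_lt_mul hn).2 (by rw [Nat.mul_comm]; omega))
    simp only [upperRowsOK, List.all_eq_true, List.mem_range'_1, decide_eq_true_eq] at h
    exact h i ⟨Nat.mul_div_le i n, Nat.lt_mul_div_succ i hn⟩
  simp only [upperSumOK, Bool.and_eq_true, decide_eq_true_eq] at hsum
  obtain ⟨⟨⟨hlen, hden⟩, hnz⟩, hineq⟩ := hsum
  have hsumeq : ∑ i ∈ Finset.range c.k, R.getD i 0 = ∑ i ∈ Finset.range c.k, c.upperRow w i :=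
    Finset.sum_congr rfl fun i hi => hrow i (Finset.mem_range.1 hi)
  simp only [upperOK, Bool.and_eq_true, decide_eq_true_eq]
  refine ⟨⟨⟨hlen, hden⟩, hnz⟩, ?_⟩
  have : ∑ i ∈ Finset.range c.k, c.upperRow w i = ∑ i ∈ Finset.range c.k, ∑ j ∈ Finset.range c.k,
      (w.getD i 0 * w.getD j 0 * c.Cij i j + |w.getD i 0| * |w.getD j 0| * (c.rij i j : ℤ)) := rfl
  rw [← this, ← hsumeq]
  exact hineq

end GramCert

/-- PROVED: the certified upper bound from the row-sharded witness check (wrapper of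
`bottomRayleigh_le_of_upperOK`). [folklore] -/
theorem bottomRayleigh_le_of_upperRows (c : GramCert) {N : ℕ} (hk : c.k = N + 1)
    (G : Matrix (Fin (N + 1)) (Fin (N + 1)) ℝ) (hG : c.Encloses G) (w R : List ℤ) (num : ℤ) (den : ℕ)
    (n s : ℕ) (hn : 0 < n) (hcover : c.k ≤ n * s)
    (hrows : ∀ q < s, c.upperRowsOK w R (n * q) n = true) (hsum : c.upperSumOK w R num den = true) :
    bottomRayleigh G ≤ (num : ℝ) / den :=
  bottomRayleigh_le_of_upperOK c hk G hG w num den (c.upperOK_of_rows w R num den n s hn hcover hrows hsum)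

end Summit.RiemannHypothesis.RiemannHypothesis.Theorems.MotivicDoor.CertPos
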